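import Summits.BirchSwinnertonDyer.Rank1Residual.GaloisImage.ExoticNoLevelTwoTau
import Literature.NumberTheory.EllipticCurves.SelmerProofs
import Literature.NumberTheory.EllipticCurves.SelmerTorsionInclusion
import HarnessLib

/-!
# Level descent of the (H.2)-`τ` and its EXOTIC reading: on an EXOTIC row Sakamoto's hypothesis
# (H.2) FAILS AT EVERY LEVEL `3^(k+1)`, `k ≥ 1` — not only at level `9`
# (cell `b2b-bsdres`, team n1011, row T-a5x-II (II.1); seat p13)

HONEST FRAMING (cell `b2b-bsdres`, run/shared/lean/b2b/bsd-rank1-residual/, verbatim in every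
file): the goal of the cell is to DELETE the COMBINATION-SHAPED residual classes of the
Birch–Swinnerton-Dyer formula for ALL analytic-rank `≤ 1` elliptic curves over `ℚ` — "full BSD
formula for every rank `≤ 1` curve in class `C`" assembled STRICTLY from published theorems — so
that the rank-`≤ 1` remainder becomes exactly the CONSTRUCTION-SHAPED classes, which are TYPED
(missing-input `Prop`s), NOT attempted. This is not "finishing BSD". Team n1011 (N10/N11, the
additive block `X4 ∧ p = 3`): research route; no claim beyond the stated classes; the label X4 and
the mark of RESIDUAL-MAP §I N11 are UNCHANGED by this file; nothing is booked. Theorems only: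
no definition, no named fact, nothing conditional; TOOL statements about the Kolyvagin-system
machinery, not about BSD.

## What and why

p267959 (`ExoticNoLevelTwoTau.lean`) proved that on an EXOTIC row (`ρ̄_{E,3}` onto, `ρ̄_{E,9}` not:
Elkies' `9`-deficient `3`-adic image) there is NO `τ ∈ Gal(ℚ̄/ℚ(μ₉))` with `E[9]/(τ − 1)E[9] ≃ ℤ/9`
— hypothesis (H.2) of [S24]/[MR04] at LEVEL `9` (`m = 2`).  Its docstring left the higher levels as
a remark ("at `k ≥ 2`, (H.2) at level `3^{k+1}` reduces to (H.2) at level `9` — NOT formalised").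
This file formalises the reduction, once for EVERY elliptic curve over `ℚ` and EVERY prime `p`:

* `LevelDescent.exists_generator_range_of_quotient_equiv` — finite abelian `p`-group bookkeeping:
  if `M` is killed by `p^(n+1)`, `#M = p^(2(n+1))`, `#M[p^n] ≤ p^(2n)` (all three hold for
  `M = E[p^(n+1)]`), and `f : M → M` is additive with `M/f(M) ≃ ℤ/p^(n+1)`, then `f(M)` is CYCLIC
  of order `p^(n+1)`: `f(M) = ℤ∙r₀` with `ord r₀ = p^(n+1)` (if every element of `f(M)` were killed
  by `p^n`, then `M/M[p^n]` would be a quotient of the cyclic `M/f(M)` killed by `p`, so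
  `#M ≤ p · #M[p^n] ≤ p^(2n+1) < #M`).
* `LevelDescent.nonempty_quotient_equiv_zmod_of_generator` — THE DESCENT STEP on `E`: for levels
  `N_A = N_B · m`, if `(τ − 1)E[N_A] = ℤ∙r₀` with `ord r₀ = N_A` and `E[N_A]/(τ − 1) ≃ ℤ/N_A`, then
  `E[N_B]/(τ − 1) ≃ ℤ/N_B`: multiplication by `m`, `π : E[N_A] ↠ E[N_B]` (ONTO by the divisibility of
  `E(ℚ̄)`, tree `zsmul_geomPoints_surjective_of_charZero`), commutes with `τ − 1`, so
  `(τ − 1)E[N_B] = π((τ − 1)E[N_A]) = ℤ∙(m r₀)` has order `N_B`, and `E[N_B]/(τ − 1)` is a quotient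
  of the cyclic `E[N_A]/(τ − 1)`, hence cyclic, of order `N_B²/N_B = N_B`.
* **`nonempty_cokerSubOne_equiv_zmod_pow_of_le`** — (H.2) DESCENDS ALONG THE LEVELS: a `τ` with
  `E[p^a]/(τ − 1) ≃+ ℤ/p^a` has `E[p^b]/(τ − 1) ≃+ ℤ/p^b` for every `b ≤ a` (any `E/ℚ`, any prime `p`).
* **`not_levelTau_pow_of_surj_three_of_not_surj_nine`** — on an EXOTIC row there is NO
  `τ ∈ Gal(ℚ̄/ℚ(μ_{3^(k+1)}))` with `E[3^(k+1)]/(τ − 1) ≃+ ℤ/3^(k+1)`, for EVERY `k ≥ 1`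
  (`rootsOfUnityFixer_le_of_dvd` + descent to level `9` + p267959).
* `not_exists_tau_level_spelling_of_exotic_of_le` — the same in the `((3:ℕ):ℤ)^k * 3` /
  `ZMod (3^(k+1))` spelling of the Sakamoto N11 instances (p255331 / p260356 / R1-23), `k ≥ 1`.

CONSEQUENCE for the crux (cell text of R5-49, now a kernel theorem at every level): on EXOTIC rows
the Kolyvagin-system theorems of the [S24]/[MR04] family are unavailable at EVERY level `m ≥ 2` for
a STRUCTURAL reason (no admissible `τ`); only the level-one line (`m = 1`, p252385 / T-a5x) exists
there.  Nothing booked; no mark / label changed.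

References: R. Sakamoto, JTNB 36 (2024) §2 (H.2) [Sakamoto2024]; B. Mazur, K. Rubin, Mem. AMS 799
(2004) §3.5 [MazurRubin2004]; N. Elkies, arXiv:math/0612734 [Elkies2006]; J. H. Silverman, *AEC*
III.6.4, VIII.§2 [SilvermanAEC2009].
-/

noncomputable section

open scoped Classical
open WeierstrassCurve Literature.NumberTheory.EllipticCurves Literature.NumberTheory.GaloisRepresentations
  Literature.NumberTheory.GaloisRepresentations.DiscreteGaloisModule Literature.NumberTheory.GaloisCohomology

namespace Summit.BirchSwinnertonDyer.Rank1Residual.GaloisImage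

namespace LevelDescent

/-! ### Finite abelian `p`-group bookkeeping -/

/-- **`f(M)` is cyclic of full order when `M/f(M) ≃ ℤ/p^(n+1)` on a group of type `(p^(n+1), p^(n+1))`.**
Let `M` be a finite additive group killed by `p^(n+1)` with `#M = p^(2(n+1))` and `#M[p^n] ≤ p^(2n)`
(e.g. `M = E[p^(n+1)]`), `f : M →+ M`, and `M ⧸ f(M) ≃+ ℤ/p^(n+1)`.  Then `f(M) = ℤ∙r₀` for some
`r₀` of order `p^(n+1)`.  PROOF: `#f(M) = p^(n+1)` (Lagrange).  If every element of `f(M)` were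
killed by `p^n`, then `f(M) ≤ K := M[p^n]`, so `M/K` is generated by the class of a generator `m₀`
of `M/f(M)`, and `p·m₀ ∈ K`; hence `#(M/K) ≤ p` and `#M = #(M/K)·#K ≤ p^(2n+1) < p^(2(n+1))`,
absurd.  So some `r₀ ∈ f(M)` has `p^n r₀ ≠ 0`, i.e. order `p^(n+1) = #f(M)`.  (Cf. n1011-p18's
`Unipotent.exists_mem_nsmul_ne_zero` (p273539): the same finite-group fact stated with an explicit
frame `(ℤ/p^K)² ≃+ V` and a cyclic quotient; here BASIS-FREE, from the three cardinality facts that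
`card_torsionPoints_eq_sq_holds` supplies for `E[p^(n+1)]`, and with the generator conclusion.)
[folklore] -/
theorem exists_generator_range_of_quotient_equiv {M : Type*} [AddCommGroup M] [Finite M]
    {p : ℕ} (hp : p.Prime) (n : ℕ)
    (hkill : ∀ x : M, ((p : ℤ) ^ (n + 1)) • x = 0)
    (hM : Nat.card M = p ^ (2 * (n + 1)))
    (hK : Nat.card (zsmulAddGroupHom (α := M) ((p : ℤ) ^ n)).ker ≤ p ^ (2 * n))
    (f : M →+ M) (e : M ⧸ f.range ≃+ ZMod (p ^ (n + 1))) :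
    ∃ r₀ ∈ f.range, addOrderOf r₀ = p ^ (n + 1) ∧ f.range = AddSubgroup.zmultiples r₀ := by
  haveI : Fact p.Prime := ⟨hp⟩
  have hp1 : 1 < p := hp.one_lt
  -- `#f(M) = p^(n+1)`
  have hQ : Nat.card (M ⧸ f.range) = p ^ (n + 1) := by
    rw [Nat.card_congr e.toEquiv, Nat.card_zmod]
  have hR : Nat.card f.range = p ^ (n + 1) := by
    have h := AddSubgroup.card_eq_card_quotient_mul_card_addSubgroup f.range
    rw [hM, hQ, show 2 * (n + 1) = (n + 1) + (n + 1) by ring, pow_add] at h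
    exact (Nat.eq_of_mul_eq_mul_left (pow_pos hp.pos _) h).symm
  -- some element of `f(M)` is not killed by `p^n`
  have hex : ∃ r ∈ f.range, ((p : ℤ) ^ n) • r ≠ 0 := by
    by_contra hcon
    push Not at hcon
    have hmemK : ∀ x : M, x ∈ (zsmulAddGroupHom (α := M) ((p : ℤ) ^ n)).ker ↔
        ((p : ℤ) ^ n) • x = 0 := fun x => by
      rw [AddMonoidHom.mem_ker, zsmulAddGroupHom_apply]
    have hRK : f.range ≤ (zsmulAddGroupHom (α := M) ((p : ℤ) ^ n)).ker :=
      fun r hr => (hmemK r).2 (hcon r hr)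
    -- a generator `m₀` of `M ⧸ f(M)`
    obtain ⟨m₀, hm₀⟩ := QuotientAddGroup.mk_surjective (e.symm 1)
    have hgen : ∀ m : M, ∃ c : ℕ, m - c • m₀ ∈ f.range := by
      intro m
      refine ⟨(e (QuotientAddGroup.mk m)).val, ?_⟩
      rw [← QuotientAddGroup.eq_zero_iff, QuotientAddGroup.mk_sub, QuotientAddGroup.mk_nsmul, hm₀,
        ← map_nsmul, nsmul_one, ZMod.natCast_zmod_val, e.symm_apply_apply, sub_self]
    -- in `M ⧸ K` every class is `c • [m₀]` with `c < p`
    have hpm₀ : p • (QuotientAddGroup.mk m₀ : M ⧸ (zsmulAddGroupHom (α := M) ((p : ℤ) ^ n)).ker) = 0 := by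
      rw [← QuotientAddGroup.mk_nsmul, QuotientAddGroup.eq_zero_iff, hmemK, ← natCast_zsmul, smul_smul,
        ← pow_succ]
      exact hkill m₀
    have hsurj : Function.Surjective fun i : Fin p =>
        (i : ℕ) • (QuotientAddGroup.mk m₀ : M ⧸ (zsmulAddGroupHom (α := M) ((p : ℤ) ^ n)).ker) := by
      intro z
      induction z using QuotientAddGroup.induction_on with
      | H m =>
        obtain ⟨c, hc⟩ := hgen m
        refine ⟨⟨c % p, Nat.mod_lt _ hp.pos⟩, ?_⟩
        have h1 : (QuotientAddGroup.mk m : M ⧸ (zsmulAddGroupHom (α := M) ((p : ℤ) ^ n)).ker) =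
            c • QuotientAddGroup.mk m₀ := by
          rw [← QuotientAddGroup.mk_nsmul, ← sub_eq_zero, ← QuotientAddGroup.mk_sub,
            QuotientAddGroup.eq_zero_iff]
          exact hRK hc
        simp only
        rw [h1]
        conv_rhs => rw [← Nat.mod_add_div c p, add_nsmul, mul_comm, ← smul_smul, hpm₀, smul_zero,
          add_zero]
    have hcardQ : Nat.card (M ⧸ (zsmulAddGroupHom (α := M) ((p : ℤ) ^ n)).ker) ≤ p := by
      have h := Nat.card_le_card_of_surjective _ hsurj
      simpa only [Nat.card_eq_fintype_card, Fintype.card_fin] using h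
    have hcardM := AddSubgroup.card_eq_card_quotient_mul_card_addSubgroup
      (zsmulAddGroupHom (α := M) ((p : ℤ) ^ n)).ker
    have hle : p ^ (2 * (n + 1)) ≤ p * p ^ (2 * n) := by
      rw [← hM, hcardM]
      exact Nat.mul_le_mul hcardQ hK
    have hlt : p * p ^ (2 * n) < p ^ (2 * (n + 1)) := by
      rw [← pow_succ', show 2 * (n + 1) = (2 * n + 1) + 1 by ring]
      exact Nat.pow_lt_pow_right hp1 (by omega)
    omega
  obtain ⟨r₀, hr₀, hr₀n⟩ := hex
  have hord : addOrderOf r₀ = p ^ (n + 1) := by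
    refine addOrderOf_eq_prime_pow (p := p) (n := n) (x := r₀) ?_ ?_
    · rwa [← natCast_zsmul, Nat.cast_pow]
    · rw [← natCast_zsmul, Nat.cast_pow]
      exact hkill r₀
  refine ⟨r₀, hr₀, hord, ?_⟩
  refine (AddSubgroup.eq_of_le_of_card_ge (AddSubgroup.zmultiples_le.mpr hr₀) ?_).symm
  rw [hR, Nat.card_zmultiples, hord]

end LevelDescent

open LevelDescent

variable (W : WeierstrassCurve ℚ) [W.IsElliptic]

/-! ### The torsion of `E/ℚ`: cardinalities -/

/-- `#E[p^j] = p^(2j)` for an elliptic curve over `ℚ` (tree `card_torsionPoints_eq_sq_holds`, Silverman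
III.6.4(b), in the `(p:ℤ)^j` spelling). [cite: SilvermanAEC2009, Cor. III.6.4(b)] -/
theorem natCard_geomTorsion_pow {p : ℕ} (hp : p.Prime) (j : ℕ) :
    Nat.card (geomTorsion W ((p : ℤ) ^ j)) = p ^ (2 * j) := by
  have h := card_torsionPoints_eq_sq_holds W (AlgebraicClosure ℚ) (n := p ^ j)
    (by exact_mod_cast pow_ne_zero j hp.ne_zero)
  rw [Nat.cast_pow] at h
  rw [mul_comm, pow_mul]
  exact h

omit [W.IsElliptic] in
/-- `E[N]` is killed by `N`. [folklore] -/
theorem zsmul_geomTorsion_eq_zero (N : ℤ) (x : geomTorsion W N) : N • x = 0 := by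
  apply Subtype.ext
  rw [AddSubgroupClass.coe_zsmul, ZeroMemClass.coe_zero]
  exact (Submodule.mem_torsionBy_iff _ _).mp x.2

/-- `#(E[p^(n+1)])[p^n] ≤ #E[p^n] = p^(2n)`: the `p^n`-torsion of `E[p^(n+1)]` injects into `E[p^n]`.
[cite: SilvermanAEC2009, Cor. III.6.4(b)] -/
theorem natCard_ker_zsmul_geomTorsion_le {p : ℕ} (hp : p.Prime) (n : ℕ) :
    Nat.card (zsmulAddGroupHom (α := geomTorsion W ((p : ℤ) ^ (n + 1))) ((p : ℤ) ^ n)).ker ≤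
      p ^ (2 * n) := by
  rw [← natCard_geomTorsion_pow W hp n]
  haveI : Finite (geomTorsion W ((p : ℤ) ^ n)) :=
    Nat.finite_of_card_ne_zero (by rw [natCard_geomTorsion_pow W hp n]; exact pow_ne_zero _ hp.ne_zero)
  refine Nat.card_le_card_of_injective
    (fun x => (⟨((x : geomTorsion W ((p : ℤ) ^ (n + 1))) : geomPoints W), ?_⟩ :
      geomTorsion W ((p : ℤ) ^ n))) ?_
  · have hx : ((p : ℤ) ^ n) • (x : geomTorsion W ((p : ℤ) ^ (n + 1))) = 0 := by
      have h := x.2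
      rw [AddMonoidHom.mem_ker, zsmulAddGroupHom_apply] at h
      exact h
    have hx' := congrArg (fun y : geomTorsion W ((p : ℤ) ^ (n + 1)) => (y : geomPoints W)) hx
    simp only [AddSubgroupClass.coe_zsmul, ZeroMemClass.coe_zero] at hx'
    exact (Submodule.mem_torsionBy_iff _ _).mpr hx'
  · intro x y hxy
    have h := congrArg (fun z : geomTorsion W ((p : ℤ) ^ n) => (z : geomPoints W)) hxy
    exact Subtype.ext (Subtype.ext h)

namespace LevelDescent

/-! ### The descent step on `E[N_A] → E[N_B]` -/

omit [W.IsElliptic] in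
/-- **The descent step.**  Levels `N_A = N_B · m` (`N_A ≠ 0`), `τ ∈ Γ_ℚ`, `f_N = τ − 1` on `E[N]`.
If `E[N_A]/f(E[N_A]) ≃+ ℤ/N_A` and `f(E[N_A]) = ℤ∙r₀` with `ord r₀ = N_A`, then
`E[N_B]/f(E[N_B]) ≃+ ℤ/N_B`.  PROOF: `π = m·(·) : E[N_A] → E[N_B]` is onto (`E(ℚ̄)` divisible) and
commutes with `f`, so `f(E[N_B]) = π(f(E[N_A])) = ℤ∙(m r₀)` has order `N_A/m = N_B` and
`E[N_B]/f(E[N_B])`, a quotient of the cyclic `E[N_A]/f(E[N_A])`, is cyclic of order `N_B²/N_B = N_B`.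
[cite: SilvermanAEC2009, Cor. III.6.4(b) and §VIII.2] -/
theorem nonempty_quotient_equiv_zmod_of_generator {NA NB m : ℕ} (hA : NA = NB * m) (hNA : NA ≠ 0)
    (hcardB : Nat.card (geomTorsion W (NB : ℤ)) = NB ^ 2)
    (τ : Field.absoluteGaloisGroup ℚ)
    (e : cokerSubOne (W.torsionGaloisModule (NA : ℤ)) τ ≃+ ZMod NA)
    (r₀ : geomTorsion W (NA : ℤ)) (hord : addOrderOf r₀ = NA)
    (hgen : (((W.torsionGaloisModule (NA : ℤ)) τ).toAddMonoidHom - AddMonoidHom.id _).range =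
      AddSubgroup.zmultiples r₀) :
    Nonempty (cokerSubOne (W.torsionGaloisModule (NB : ℤ)) τ ≃+ ZMod NB) := by
  have hNB : NB ≠ 0 := fun h => hNA (by rw [hA, h, zero_mul])
  have hm : m ≠ 0 := fun h => hNA (by rw [hA, h, mul_zero])
  haveI : NeZero NB := ⟨hNB⟩
  -- the two maps `f = τ - 1`
  obtain ⟨fA, hfA⟩ : ∃ f : geomTorsion W (NA : ℤ) →+ geomTorsion W (NA : ℤ),
      f = ((W.torsionGaloisModule (NA : ℤ)) τ).toAddMonoidHom - AddMonoidHom.id _ := ⟨_, rfl⟩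
  obtain ⟨fB, hfB⟩ : ∃ f : geomTorsion W (NB : ℤ) →+ geomTorsion W (NB : ℤ),
      f = ((W.torsionGaloisModule (NB : ℤ)) τ).toAddMonoidHom - AddMonoidHom.id _ := ⟨_, rfl⟩
  rw [← hfA] at hgen
  have hfAapp : ∀ x, fA x = τ • x - x := fun x => by rw [hfA]; rfl
  have hfBapp : ∀ x, fB x = τ • x - x := fun x => by rw [hfB]; rfl
  -- `π = m • (·) : E[N_A] → E[N_B]`
  have hdiv : ((NA : ℕ) : ℤ) ∣ ((NB : ℕ) : ℤ) * (m : ℤ) := by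
    rw [hA, Nat.cast_mul]
  let π : geomTorsion W (NA : ℤ) →+ geomTorsion W (NB : ℤ) := geomTorsionZSMul W (m : ℤ) hdiv
  have hπcoe : ∀ x : geomTorsion W (NA : ℤ), ((π x : geomTorsion W (NB : ℤ)) : geomPoints W) =
      (m : ℤ) • (x : geomPoints W) := fun x => rfl
  -- `π` commutes with `τ - 1`
  have hcomm : ∀ x, π (fA x) = fB (π x) := fun x => by
    rw [hfAapp, hfBapp, map_sub, geomTorsionZSMul_smul]
  -- `π` is onto (divisibility of `E(ℚ̄)`)
  have hπsurj : Function.Surjective π := by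
    intro y
    obtain ⟨Q, hQ⟩ := W.zsmul_geomPoints_surjective_of_charZero (n := (m : ℤ))
      (by exact_mod_cast hm) (y : geomPoints W)
    have hQmem : Q ∈ geomTorsion W (NA : ℤ) := by
      refine (Submodule.mem_torsionBy_iff _ _).mpr ?_
      have hy : ((NB : ℕ) : ℤ) • (y : geomPoints W) = 0 := (Submodule.mem_torsionBy_iff _ _).mp y.2
      simp only at hQ
      rw [hA, Nat.cast_mul, mul_smul, hQ, hy]
    refine ⟨⟨Q, hQmem⟩, Subtype.ext ?_⟩
    rw [hπcoe]
    exact hQ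
  -- `fB(E[N_B]) = π(fA(E[N_A])) = ℤ∙(π r₀)`
  have hrangeB : fB.range = AddSubgroup.zmultiples (π r₀) := by
    rw [← AddMonoidHom.map_zmultiples, ← hgen]
    ext y
    constructor
    · rintro ⟨x, rfl⟩
      obtain ⟨x', rfl⟩ := hπsurj x
      exact ⟨fA x', ⟨x', rfl⟩, hcomm x'⟩
    · rintro ⟨z, ⟨x, rfl⟩, rfl⟩
      exact ⟨π x, (hcomm x).symm⟩
  -- order of `π r₀` is `N_B`
  have hordB : addOrderOf (π r₀) = NB := by
    have h1 : ((π r₀ : geomTorsion W (NB : ℤ)) : geomPoints W) = m • ((r₀ : geomPoints W)) := by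
      rw [hπcoe, natCast_zsmul]
    have h2 : addOrderOf (π r₀) = addOrderOf (m • (r₀ : geomPoints W)) := by
      rw [← AddSubgroup.addOrderOf_coe, h1]
    have hordcoe : addOrderOf (r₀ : geomPoints W) = NA := by rw [AddSubgroup.addOrderOf_coe, hord]
    rw [h2, addOrderOf_nsmul_of_dvd hm (by rw [hordcoe, hA]; exact Dvd.intro_left _ rfl), hordcoe, hA,
      Nat.mul_div_cancel _ (Nat.pos_of_ne_zero hm)]
  -- the quotient at level `N_B` is cyclic …
  have hle : fA.range ≤ fB.range.comap π := by
    rintro _ ⟨x, rfl⟩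
    exact ⟨π x, (hcomm x).symm⟩
  have hcycA : IsAddCyclic (geomTorsion W (NA : ℤ) ⧸ fA.range) := by
    have e' : (geomTorsion W (NA : ℤ) ⧸ fA.range) ≃+ ZMod NA := by rw [hfA]; exact e
    exact isAddCyclic_of_surjective e'.symm.toAddMonoidHom e'.symm.surjective
  have hcycB : IsAddCyclic (geomTorsion W (NB : ℤ) ⧸ fB.range) := by
    haveI := hcycA
    refine isAddCyclic_of_surjective (QuotientAddGroup.map fA.range fB.range π hle) ?_
    intro z
    induction z using QuotientAddGroup.induction_on with
    | H y =>
      obtain ⟨x, rfl⟩ := hπsurj y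
      exact ⟨QuotientAddGroup.mk x, rfl⟩
  -- … of order `N_B`
  have hcardR : Nat.card fB.range = NB := by
    rw [hrangeB, Nat.card_zmultiples, hordB]
  have hcardQ : Nat.card (geomTorsion W (NB : ℤ) ⧸ fB.range) = NB := by
    have h := AddSubgroup.card_eq_card_quotient_mul_card_addSubgroup fB.range
    rw [hcardB, hcardR, pow_two] at h
    exact (Nat.eq_of_mul_eq_mul_right (Nat.pos_of_ne_zero hNB) h).symm
  have eB : ZMod (Nat.card (geomTorsion W (NB : ℤ) ⧸ fB.range)) ≃+ (geomTorsion W (NB : ℤ) ⧸ fB.range) :=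
    zmodAddCyclicAddEquiv hcycB
  rw [hcardQ] at eB
  rw [hfB] at eB
  exact ⟨eB.symm⟩

end LevelDescent

/-! ### (H.2) descends along the levels -/

/-- **The (H.2)-`τ` DESCENDS: a `τ` with `E[p^a]/(τ − 1)E[p^a] ≃+ ℤ/p^a` has
`E[p^b]/(τ − 1)E[p^b] ≃+ ℤ/p^b` for every `b ≤ a`** (any elliptic curve over `ℚ`, any prime `p`).
From `LevelDescent.exists_generator_range_of_quotient_equiv` (the image of `τ − 1` on `E[p^a]` is
cyclic of order `p^a`) and `LevelDescent.nonempty_quotient_equiv_zmod_of_generator` (descent along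
`p^(a−b)·(·) : E[p^a] ↠ E[p^b]`).  Used below on EXOTIC rows with `(p, b) = (3, 2)`; a tool lemma for
any consumer that needs the Sakamoto `τ`-datum at a lower level than the one it was produced at.
[cite: Sakamoto2024, §2 hypothesis (H.2) (p. 921)] [cite: SilvermanAEC2009, Cor. III.6.4(b) and §VIII.2] -/
theorem nonempty_cokerSubOne_equiv_zmod_pow_of_le {p : ℕ} (hp : p.Prime) {a b : ℕ} (hba : b ≤ a)
    (τ : Field.absoluteGaloisGroup ℚ)
    (hτ : Nonempty (cokerSubOne (W.torsionGaloisModule ((p : ℤ) ^ a)) τ ≃+ ZMod (p ^ a))) :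
    Nonempty (cokerSubOne (W.torsionGaloisModule ((p : ℤ) ^ b)) τ ≃+ ZMod (p ^ b)) := by
  obtain _ | n := a
  · obtain rfl : b = 0 := Nat.le_zero.mp hba
    exact hτ
  obtain ⟨e⟩ := hτ
  haveI : Finite (geomTorsion W ((p : ℤ) ^ (n + 1))) :=
    Nat.finite_of_card_ne_zero (by rw [natCard_geomTorsion_pow W hp (n + 1)]; exact pow_ne_zero _ hp.ne_zero)
  obtain ⟨r₀, -, hord, hgen⟩ := exists_generator_range_of_quotient_equiv hp n
    (zsmul_geomTorsion_eq_zero W ((p : ℤ) ^ (n + 1))) (natCard_geomTorsion_pow W hp (n + 1))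
    (natCard_ker_zsmul_geomTorsion_le W hp n) _ e
  have hA : p ^ (n + 1) = p ^ b * p ^ (n + 1 - b) := by
    rw [← pow_add, Nat.add_sub_cancel' hba]
  have hcast : ((p ^ (n + 1) : ℕ) : ℤ) = (p : ℤ) ^ (n + 1) := by rw [Nat.cast_pow]
  have hcastB : ((p ^ b : ℕ) : ℤ) = (p : ℤ) ^ b := by rw [Nat.cast_pow]
  have h := nonempty_quotient_equiv_zmod_of_generator W hA (pow_ne_zero _ hp.ne_zero)
    (by rw [hcastB, natCard_geomTorsion_pow W hp b, mul_comm, pow_mul]) τ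
  rw [hcast, hcastB] at h
  exact h e r₀ hord hgen

/-! ### The EXOTIC reading: no (H.2)-`τ` at any level `3^(k+1)`, `k ≥ 1` -/

/-- **(H.2) FAILS AT EVERY LEVEL `3^(k+1)`, `k ≥ 1`, on an EXOTIC row.**  If `ρ̄_{E,3}` is onto and
`ρ̄_{E,9}` is not (Elkies' `9`-deficient `3`-adic image), then for every `k ≥ 1` there is NO
`τ ∈ Gal(ℚ̄/ℚ(μ_{3^(k+1)}))` with `E[3^(k+1)]/(τ − 1)E[3^(k+1)] ≃+ ℤ/3^(k+1)`: such a `τ` fixes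
`μ₉` (`rootsOfUnityFixer_le_of_dvd`) and, by the level descent
`nonempty_cokerSubOne_equiv_zmod_pow_of_le`, would give `E[9]/(τ − 1)E[9] ≃+ ℤ/9`, which p267959
`not_levelTwoTau_of_surj_three_of_not_surj_nine` forbids.  So on EXOTIC rows Sakamoto's / Mazur–Rubin's
`τ`-datum exists ONLY at level `3` (`m = 1`, from surj(3) alone): the Kolyvagin-system line is void
at every `m ≥ 2`, structurally.  Nothing booked; no mark / label changed.
[cite: Sakamoto2024, §2 hypothesis (H.2) (p. 921)] [cite: Elkies2006, §1–§2] -/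
theorem not_levelTau_pow_of_surj_three_of_not_surj_nine
    (hsurj : W.HasSurjectiveModNGaloisRep 3) (hnot : ¬ W.HasSurjectiveModNGaloisRep 9)
    {k : ℕ} (hk : 1 ≤ k) (τ : Field.absoluteGaloisGroup ℚ)
    (hτμ : τ ∈ rootsOfUnityFixer ℚ (3 ^ (k + 1)))
    (hτq : Nonempty (cokerSubOne (W.torsionGaloisModule ((3 : ℤ) ^ (k + 1))) τ ≃+ ZMod (3 ^ (k + 1)))) :
    False := by
  have hτμ9 : τ ∈ rootsOfUnityFixer ℚ 9 :=
    rootsOfUnityFixer_le_of_dvd ℚ (show 9 ∣ 3 ^ (k + 1) from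
      ⟨3 ^ (k - 1), by rw [show (9 : ℕ) = 3 ^ 2 by norm_num, ← pow_add]; congr 1; omega⟩) hτμ
  have h9 := nonempty_cokerSubOne_equiv_zmod_pow_of_le W Nat.prime_three (a := k + 1) (b := 2)
    (by omega) τ (by exact_mod_cast hτq)
  have hlevel : ((3 : ℕ) : ℤ) ^ 2 = 9 := by norm_num
  rw [hlevel] at h9
  exact not_levelTwoTau_of_surj_three_of_not_surj_nine W hsurj hnot τ hτμ9 (by simpa using h9)

/-- **The N11 reading at every `k ≥ 1`: the `τ`-binder of the Sakamoto instances is UNSATISFIABLE on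
EXOTIC rows at every level above one.**  In the spelling of p255331 / p260356 / R1-23 —
`τ ∈ rootsOfUnityFixer ℚ (3^(k+1))`, `cokerSubOne (W.torsionGaloisModule ((3:ℤ)^k·3)) τ ≃+ ZMod (3^(k+1))`
— no such `τ` exists for ANY `k ≥ 1` when `ρ̄_{E,3}` is onto and `ρ̄_{E,9}` is not (p267959 is the case
`k = 1`).  Nothing booked. [cite: Sakamoto2024, §2 hypothesis (H.2) (p. 921)] [cite: Elkies2006, §1–§2] -/
theorem not_exists_tau_level_spelling_of_exotic_of_le
    (hsurj : W.HasSurjectiveModNGaloisRep 3) (hnot : ¬ W.HasSurjectiveModNGaloisRep 9)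
    {k : ℕ} (hk : 1 ≤ k) :
    ¬ ∃ τ : Field.absoluteGaloisGroup ℚ, τ ∈ rootsOfUnityFixer ℚ (3 ^ (k + 1)) ∧
      Nonempty (cokerSubOne (W.torsionGaloisModule (((3 : ℕ) : ℤ) ^ k * ((3 : ℕ) : ℤ))) τ ≃+
        ZMod (3 ^ (k + 1))) := by
  rintro ⟨τ, hτμ, hτq⟩
  have hlevel : ((3 : ℕ) : ℤ) ^ k * ((3 : ℕ) : ℤ) = (3 : ℤ) ^ (k + 1) := by
    rw [← pow_succ]; norm_num
  rw [hlevel] at hτq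
  exact not_levelTau_pow_of_surj_three_of_not_surj_nine W hsurj hnot hk τ hτμ hτq

end Summit.BirchSwinnertonDyer.Rank1Residual.GaloisImage

end
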